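import Summits.AtomisticToContinuum.HydrodynamicLimit.Theorems.EnskogAdjointDualityAdjointEnskogTestFamilyRPairGaussianEqual
import HarnessLib

/-!
# EnskogAdjointDuality / AdjointEnskogTestFamilyR — stub B3a: the Gaussian pair integrals

Closes the registered stub `stub_pairGaussian` (Prop `PairGaussian`) of the birth line of the crux
`Summit.AtomisticToContinuum.HydrodynamicLimit.Theses.EnskogAdjointDuality.AdjointEnskogTestFamilyR`
(stmt-AtomisticToContinuum-11592, K2R clause (v)): the Enskog collision operator tested on the hydrodynamic
part of the test function produces, for each position and impact direction `ω`, the Gaussian pair integrals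
`J₁ = ∫∫ q₊ q M_{θ,u}(v) M_{θ',u'}(w)` and `J₂ = ∫∫ q₊ q ((v+w)·ω/2) M_{θ,u}(v) M_{θ',u'}(w)`, `q = (v−w)·ω`.

* `k2r_pair_integral_lipschitz` — Lipschitz dependence of `∫∫ k(v,w) M_{θ,u}(v) M_{θ',u'}(w)` on
  `(θ', u')` at `(θ, u)` for kernels of cubic growth, locally Lipschitz in `w` (Gaussian coupling
  `w = u' + √θ' z`, `w̃ = u + √θ z`, `z ∼ stdGaussian`; `√·` is Lipschitz above `θm > 0`);
* `stub_pairGaussian` — (i) `J₁ = θ` and (ii) `J₂ = θ (u·ω)` at equal parameters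
  (`k2r_pairGaussian_fst/snd`), (iii) `|J₁ − θ|, |J₂ − θ(u·ω)| ≤ K(θm, Θ, U) (|θ − θ'| + ‖u − u'‖)` on
  `θm ≤ θ, θ' ≤ Θ`, `‖u‖, ‖u'‖ ≤ U`.

References: C. Cercignani, R. Illner, M. Pulvirenti, *The Mathematical Theory of Dilute Gases* (1994),
§3.1 [CIP1994]; S. Chapman, T. G. Cowling, *The Mathematical Theory of Non-uniform Gases* (1970), §16
[ChapmanCowling1970].
-/

noncomputable section

open MeasureTheory ProbabilityTheory Metric Set Filter Topology Function
open scoped InnerProductSpace ENNReal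

namespace Summit.AtomisticToContinuum.HydrodynamicLimit.Theorems.EnskogAdjointDuality

open Literature.Analysis.FluidPDE Literature.MathematicalPhysics.KineticTheory

/-! ## Lipschitz dependence on the second Maxwellian (Gaussian coupling) -/

section Lipschitz

/-- Square roots are Lipschitz above a positive floor: `|√θ − √θ'| ≤ |θ − θ'| / (2√θm)` for
`θ, θ' ≥ θm > 0`. [folklore] -/
theorem k2r_abs_sqrt_sub_sqrt_le {θm θ θ' : ℝ} (hθm : 0 < θm) (hθ : θm ≤ θ) (hθ' : θm ≤ θ') :
    |Real.sqrt θ - Real.sqrt θ'| ≤ (2 * Real.sqrt θm)⁻¹ * |θ - θ'| := by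
  have hsm : 0 < Real.sqrt θm := Real.sqrt_pos.2 hθm
  have hsum : 2 * Real.sqrt θm ≤ Real.sqrt θ + Real.sqrt θ' := by
    have h1 := Real.sqrt_le_sqrt hθ
    have h2 := Real.sqrt_le_sqrt hθ'
    linarith
  have hpos : 0 < Real.sqrt θ + Real.sqrt θ' := by linarith
  have hkey : (Real.sqrt θ - Real.sqrt θ') * (Real.sqrt θ + Real.sqrt θ') = θ - θ' := by
    have ha := Real.mul_self_sqrt (hθm.le.trans hθ)
    have hb := Real.mul_self_sqrt (hθm.le.trans hθ')
    linear_combination ha - hb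
  have habs : |Real.sqrt θ - Real.sqrt θ'| = |θ - θ'| / (Real.sqrt θ + Real.sqrt θ') := by
    rw [eq_div_iff hpos.ne', ← hkey, abs_mul, abs_of_pos hpos]
  rw [habs, inv_mul_eq_div]
  exact div_le_div_of_nonneg_left (abs_nonneg _) (by positivity) hsum

/-- Elementary: `1 + x + t ≤ (1 + U + S)(1 + x)(1 + y)` whenever `t ≤ U + S y` and everything is
nonnegative. [folklore] -/
theorem k2r_one_add_add_le_mul {x y t U S : ℝ} (hx : 0 ≤ x) (hy : 0 ≤ y) (hU : 0 ≤ U) (hS : 0 ≤ S)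
    (ht : t ≤ U + S * y) : 1 + x + t ≤ (1 + U + S) * (1 + x) * (1 + y) := by
  nlinarith [mul_nonneg hU hx, mul_nonneg hU hy, mul_nonneg (mul_nonneg hU hx) hy,
    mul_nonneg hS hx, mul_nonneg (mul_nonneg hS hx) hy, mul_nonneg hx hy]

/-- Elementary: `1 + x + t + t' ≤ 2 (1 + U + S)(1 + x)(1 + y)` whenever `t, t' ≤ U + S y` and
everything is nonnegative. [folklore] -/
theorem k2r_one_add_add_add_le_mul {x y t t' U S : ℝ} (hx : 0 ≤ x) (hy : 0 ≤ y) (hU : 0 ≤ U)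
    (hS : 0 ≤ S) (ht : t ≤ U + S * y) (ht' : t' ≤ U + S * y) :
    1 + x + t + t' ≤ 2 * (1 + U + S) * (1 + x) * (1 + y) := by
  nlinarith [mul_nonneg hU hx, mul_nonneg hU hy, mul_nonneg (mul_nonneg hU hx) hy,
    mul_nonneg hS hx, mul_nonneg (mul_nonneg hS hx) hy, mul_nonneg hx hy]

/-- **Lipschitz dependence of a Maxwellian pair integral on the parameters of the second Maxwellian.**
For a continuous kernel `k(v, w)` with `|k(v,w)| ≤ (1+‖v‖+‖w‖)³` and
`|k(v,w) − k(v,w')| ≤ 3(1+‖v‖+‖w‖+‖w'‖)² ‖w − w'‖`, on the range `θm ≤ θ, θ' ≤ Θ`, `‖u‖, ‖u'‖ ≤ U`: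
`|∫∫ k M_{θ,u}(v) M_{θ',u'}(w) − ∫∫ k M_{θ,u}(v) M_{θ,u}(w)| ≤ K (|θ − θ'| + ‖u − u'‖)` with
`K = 12 (1+|U|+√Θ)⁴ (1 + 1/(2√θm)) Z₂ Z₃`, `Z_n = ∫ (1+‖z‖)ⁿ dγ`. Proof: couple the two second
Maxwellians through `w = u' + √θ' z`, `w̃ = u + √θ z`, `z ∼ γ = stdGaussian`, so that
`‖w − w̃‖ ≤ ‖u − u'‖ + |√θ − √θ'| ‖z‖`, and integrate the polynomial bounds. [folklore] -/
theorem k2r_pair_integral_lipschitz {θm Θ U : ℝ} (hθm : 0 < θm) (k : V3 → V3 → ℝ)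
    (hkc : Continuous fun p : V3 × V3 => k p.1 p.2)
    (hkb : ∀ v w, |k v w| ≤ (1 + ‖v‖ + ‖w‖) ^ 3)
    (hkl : ∀ v w w', |k v w - k v w'| ≤ 3 * (1 + ‖v‖ + ‖w‖ + ‖w'‖) ^ 2 * ‖w - w'‖)
    {θ θ' : ℝ} {u u' : V3} (hθ : θm ≤ θ) (hθΘ : θ ≤ Θ) (hθ' : θm ≤ θ') (hθ'Θ : θ' ≤ Θ)
    (hu : ‖u‖ ≤ U) (hu' : ‖u'‖ ≤ U) :
    |(∫ v, ∫ w, k v w * (localMaxwellian 1 θ u v * localMaxwellian 1 θ' u' w)) -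
        ∫ v, ∫ w, k v w * (localMaxwellian 1 θ u v * localMaxwellian 1 θ u w)| ≤
      12 * (1 + |U| + Real.sqrt Θ) ^ 4 * (1 + (2 * Real.sqrt θm)⁻¹) *
        ((∫ z, (1 + ‖z‖) ^ 2 ∂stdGaussian V3) * ∫ z, (1 + ‖z‖) ^ 3 ∂stdGaussian V3) *
        (|θ - θ'| + ‖u - u'‖) := by
  have hθ0 : 0 < θ := hθm.trans_le hθ
  have hθ'0 : 0 < θ' := hθm.trans_le hθ'
  have hTc : Continuous fun z : V3 => u + Real.sqrt θ • z := by fun_prop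
  have hT'c : Continuous fun z : V3 => u' + Real.sqrt θ' • z := by fun_prop
  set A : ℝ := 1 + |U| + Real.sqrt Θ with hA
  set L : ℝ := 1 + (2 * Real.sqrt θm)⁻¹ with hL
  set Z2 : ℝ := ∫ z, (1 + ‖z‖) ^ 2 ∂stdGaussian V3 with hZ2
  set Z3 : ℝ := ∫ z, (1 + ‖z‖) ^ 3 ∂stdGaussian V3 with hZ3
  set δ : ℝ := |θ - θ'| + ‖u - u'‖ with hδ
  set M : V3 → ℝ := localMaxwellian 1 θ u with hM
  set T : V3 → V3 := fun z => u + Real.sqrt θ • z with hT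
  set T' : V3 → V3 := fun z => u' + Real.sqrt θ' • z with hT'
  have hU0 : 0 ≤ |U| := abs_nonneg U
  have hSΘ : 0 ≤ Real.sqrt Θ := Real.sqrt_nonneg Θ
  have hA1 : 1 ≤ A := by rw [hA]; linarith
  have hc0 : 0 ≤ (2 * Real.sqrt θm)⁻¹ := by positivity
  have hL1 : 1 ≤ L := by rw [hL]; linarith
  have hZ3_0 : 0 ≤ Z3 := integral_nonneg fun z => by positivity
  have hδ0 : 0 ≤ δ := by positivity
  have hMv : ∀ v, 0 ≤ M v := fun v => localMaxwellian_nonneg zero_le_one hθ0.le u v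
  -- size of the coupled velocities
  have hcouple : ∀ (u₁ : V3) (θ₁ : ℝ), ‖u₁‖ ≤ U → θ₁ ≤ Θ → ∀ z : V3,
      ‖u₁ + Real.sqrt θ₁ • z‖ ≤ |U| + Real.sqrt Θ * ‖z‖ := by
    intro u₁ θ₁ hu₁ hθ₁ z
    calc ‖u₁ + Real.sqrt θ₁ • z‖ ≤ ‖u₁‖ + ‖Real.sqrt θ₁ • z‖ := norm_add_le _ _
      _ = ‖u₁‖ + Real.sqrt θ₁ * ‖z‖ := by
          rw [norm_smul, Real.norm_eq_abs, abs_of_nonneg (Real.sqrt_nonneg θ₁)]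
      _ ≤ |U| + Real.sqrt Θ * ‖z‖ := by
          gcongr
          · exact hu₁.trans (le_abs_self U)
  have hTz : ∀ z, ‖T z‖ ≤ |U| + Real.sqrt Θ * ‖z‖ := hcouple u θ hu hθΘ
  have hT'z : ∀ z, ‖T' z‖ ≤ |U| + Real.sqrt Θ * ‖z‖ := hcouple u' θ' hu' hθ'Θ
  -- distance of the coupled velocities
  have hTT' : ∀ z, ‖T' z - T z‖ ≤ L * (1 + ‖z‖) * δ := by
    intro z
    have hz := norm_nonneg z
    have e0 : T' z - T z = (u' - u) + (Real.sqrt θ' - Real.sqrt θ) • z := by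
      simp only [hT, hT', sub_smul]; abel
    have e1 : ‖T' z - T z‖ ≤ ‖u - u'‖ + (2 * Real.sqrt θm)⁻¹ * |θ - θ'| * ‖z‖ := by
      rw [e0]
      calc ‖(u' - u) + (Real.sqrt θ' - Real.sqrt θ) • z‖
          ≤ ‖u' - u‖ + ‖(Real.sqrt θ' - Real.sqrt θ) • z‖ := norm_add_le _ _
        _ = ‖u - u'‖ + |Real.sqrt θ' - Real.sqrt θ| * ‖z‖ := by
            rw [norm_sub_rev, norm_smul, Real.norm_eq_abs]
        _ ≤ ‖u - u'‖ + (2 * Real.sqrt θm)⁻¹ * |θ - θ'| * ‖z‖ := by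
            have h := k2r_abs_sqrt_sub_sqrt_le hθm hθ' hθ
            rw [abs_sub_comm θ' θ] at h
            gcongr
    have e2 : ‖u - u'‖ ≤ L * (1 + ‖z‖) * ‖u - u'‖ :=
      le_mul_of_one_le_left (norm_nonneg _) (one_le_mul_of_one_le_of_one_le hL1 (by linarith))
    have e3 : (2 * Real.sqrt θm)⁻¹ * |θ - θ'| * ‖z‖ ≤ L * (1 + ‖z‖) * |θ - θ'| := by
      have : (2 * Real.sqrt θm)⁻¹ * ‖z‖ ≤ L * (1 + ‖z‖) := by rw [hL]; nlinarith
      calc (2 * Real.sqrt θm)⁻¹ * |θ - θ'| * ‖z‖ = (2 * Real.sqrt θm)⁻¹ * ‖z‖ * |θ - θ'| := by ring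
        _ ≤ L * (1 + ‖z‖) * |θ - θ'| := mul_le_mul_of_nonneg_right this (abs_nonneg _)
    calc ‖T' z - T z‖ ≤ ‖u - u'‖ + (2 * Real.sqrt θm)⁻¹ * |θ - θ'| * ‖z‖ := e1
      _ ≤ L * (1 + ‖z‖) * ‖u - u'‖ + L * (1 + ‖z‖) * |θ - θ'| := add_le_add e2 e3
      _ = L * (1 + ‖z‖) * δ := by rw [hδ]; ring
  -- pointwise bounds on the kernel along the coupling
  have hbT : ∀ (S : V3 → V3), (∀ z, ‖S z‖ ≤ |U| + Real.sqrt Θ * ‖z‖) → ∀ v z,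
      |k v (S z)| ≤ A ^ 3 * (1 + ‖v‖) ^ 3 * (1 + ‖z‖) ^ 3 := by
    intro S hS v z
    have h1 : 1 + ‖v‖ + ‖S z‖ ≤ A * (1 + ‖v‖) * (1 + ‖z‖) :=
      k2r_one_add_add_le_mul (norm_nonneg v) (norm_nonneg z) hU0 hSΘ (hS z)
    calc |k v (S z)| ≤ (1 + ‖v‖ + ‖S z‖) ^ 3 := hkb v (S z)
      _ ≤ (A * (1 + ‖v‖) * (1 + ‖z‖)) ^ 3 := pow_le_pow_left₀ (by positivity) h1 3
      _ = A ^ 3 * (1 + ‖v‖) ^ 3 * (1 + ‖z‖) ^ 3 := by ring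
  have hb2 : ∀ v z, |k v (T' z) - k v (T z)| ≤
      12 * A ^ 2 * L * δ * (1 + ‖v‖) ^ 2 * (1 + ‖z‖) ^ 3 := by
    intro v z
    have hS : 1 + ‖v‖ + ‖T' z‖ + ‖T z‖ ≤ 2 * A * (1 + ‖v‖) * (1 + ‖z‖) :=
      k2r_one_add_add_add_le_mul (norm_nonneg v) (norm_nonneg z) hU0 hSΘ (hT'z z) (hTz z)
    have hd := hTT' z
    calc |k v (T' z) - k v (T z)| ≤ 3 * (1 + ‖v‖ + ‖T' z‖ + ‖T z‖) ^ 2 * ‖T' z - T z‖ :=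
          hkl v (T' z) (T z)
      _ ≤ 3 * (2 * A * (1 + ‖v‖) * (1 + ‖z‖)) ^ 2 * (L * (1 + ‖z‖) * δ) := by gcongr
      _ = 12 * A ^ 2 * L * δ * (1 + ‖v‖) ^ 2 * (1 + ‖z‖) ^ 3 := by ring
  -- the inner integrals through the coupling
  set Φ' : V3 → ℝ := fun v => ∫ z, k v (T' z) ∂stdGaussian V3 with hΦ'
  set Φ : V3 → ℝ := fun v => ∫ z, k v (T z) ∂stdGaussian V3 with hΦ
  have hJ' : (∫ v, ∫ w, k v w * (M v * localMaxwellian 1 θ' u' w)) = ∫ v, M v * Φ' v :=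
    integral_congr_ae (Eventually.of_forall fun v =>
      k2r_integral_weight_mul_localMaxwellian_pair θ hθ'0 u u' (k v) v)
  have hJ : (∫ v, ∫ w, k v w * (M v * M w)) = ∫ v, M v * Φ v :=
    integral_congr_ae (Eventually.of_forall fun v =>
      k2r_integral_weight_mul_localMaxwellian_pair θ hθ0 u u (k v) v)
  -- integrability in `z`
  have hiz : ∀ (S : V3 → V3), Continuous S → (∀ z, ‖S z‖ ≤ |U| + Real.sqrt Θ * ‖z‖) → ∀ v,
      Integrable (fun z => k v (S z)) (stdGaussian V3) := by
    intro S hSc hS v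
    have hc : Continuous fun z : V3 => k v (S z) :=
      hkc.comp (continuous_const.prodMk hSc)
    refine Integrable.mono' ((k2r_integrable_one_add_norm_pow_stdGaussian 3).const_mul
      (A ^ 3 * (1 + ‖v‖) ^ 3)) hc.aestronglyMeasurable (Eventually.of_forall fun z => ?_)
    rw [Real.norm_eq_abs]
    exact (hbT S hS v z).trans_eq (by ring)
  -- measurability in `v`
  have hΦm : ∀ (S : V3 → V3), Continuous S →
      AEStronglyMeasurable (fun v => ∫ z, k v (S z) ∂stdGaussian V3) volume := by
    intro S hSc
    have hc : Continuous fun p : V3 × V3 => k p.1 (S p.2) :=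
      hkc.comp (continuous_fst.prodMk (hSc.comp continuous_snd))
    exact (hc.stronglyMeasurable.integral_prod_right' (ν := stdGaussian V3)).aestronglyMeasurable
  -- bounds on `Φ'`, `Φ` and their difference
  have hΦb : ∀ (S : V3 → V3), (∀ z, ‖S z‖ ≤ |U| + Real.sqrt Θ * ‖z‖) → ∀ v,
      |∫ z, k v (S z) ∂stdGaussian V3| ≤ A ^ 3 * Z3 * (1 + ‖v‖) ^ 3 := by
    intro S hS v
    have h := norm_integral_le_of_norm_le
      ((k2r_integrable_one_add_norm_pow_stdGaussian 3).const_mul (A ^ 3 * (1 + ‖v‖) ^ 3))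
      (Eventually.of_forall fun z =>
        (show ‖k v (S z)‖ ≤ A ^ 3 * (1 + ‖v‖) ^ 3 * (1 + ‖z‖) ^ 3 from by
          rw [Real.norm_eq_abs]; exact hbT S hS v z))
    rw [Real.norm_eq_abs, integral_const_mul] at h
    exact h.trans_eq (by rw [hZ3]; ring)
  have hDb : ∀ v, |Φ' v - Φ v| ≤ 12 * A ^ 2 * L * δ * Z3 * (1 + ‖v‖) ^ 2 := by
    intro v
    have hsub : Φ' v - Φ v = ∫ z, (k v (T' z) - k v (T z)) ∂stdGaussian V3 :=
      (integral_sub (hiz T' hT'c hT'z v) (hiz T hTc hTz v)).symm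
    rw [hsub]
    have h := norm_integral_le_of_norm_le
      ((k2r_integrable_one_add_norm_pow_stdGaussian 3).const_mul
        (12 * A ^ 2 * L * δ * (1 + ‖v‖) ^ 2))
      (Eventually.of_forall fun z =>
        (show ‖k v (T' z) - k v (T z)‖ ≤ 12 * A ^ 2 * L * δ * (1 + ‖v‖) ^ 2 * (1 + ‖z‖) ^ 3 from by
          rw [Real.norm_eq_abs]; exact hb2 v z))
    rw [Real.norm_eq_abs, integral_const_mul] at h
    exact h.trans_eq (by rw [hZ3]; ring)
  -- integrability in `v`
  have hiv : ∀ (S : V3 → V3), Continuous S → (∀ z, ‖S z‖ ≤ |U| + Real.sqrt Θ * ‖z‖) →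
      Integrable (fun v => M v * ∫ z, k v (S z) ∂stdGaussian V3) := by
    intro S hSc hS
    refine Integrable.mono' ((integrable_one_add_norm_pow_mul_localMaxwellian hθ0 u 3).const_mul
      (A ^ 3 * Z3)) ((continuous_localMaxwellian 1 θ u).aestronglyMeasurable.mul (hΦm S hSc))
      (Eventually.of_forall fun v => ?_)
    rw [Real.norm_eq_abs, abs_mul, abs_of_nonneg (hMv v)]
    calc M v * |∫ z, k v (S z) ∂stdGaussian V3| ≤ M v * (A ^ 3 * Z3 * (1 + ‖v‖) ^ 3) :=
          mul_le_mul_of_nonneg_left (hΦb S hS v) (hMv v)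
      _ = A ^ 3 * Z3 * ((1 + ‖v‖) ^ 3 * localMaxwellian 1 θ u v) := by rw [hM]; ring
  -- the estimate
  rw [hJ', hJ, ← integral_sub (hiv T' hT'c hT'z) (hiv T hTc hTz)]
  have hpt : ∀ v, ‖M v * Φ' v - M v * Φ v‖ ≤
      (12 * A ^ 2 * L * δ * Z3) * ((1 + ‖v‖) ^ 2 * localMaxwellian 1 θ u v) := by
    intro v
    rw [← mul_sub, Real.norm_eq_abs, abs_mul, abs_of_nonneg (hMv v)]
    calc M v * |Φ' v - Φ v| ≤ M v * (12 * A ^ 2 * L * δ * Z3 * (1 + ‖v‖) ^ 2) :=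
          mul_le_mul_of_nonneg_left (hDb v) (hMv v)
      _ = (12 * A ^ 2 * L * δ * Z3) * ((1 + ‖v‖) ^ 2 * localMaxwellian 1 θ u v) := by rw [hM]; ring
  have hgi : Integrable (fun v => (12 * A ^ 2 * L * δ * Z3) * ((1 + ‖v‖) ^ 2 * localMaxwellian 1 θ u v)) :=
    (integrable_one_add_norm_pow_mul_localMaxwellian hθ0 u 2).const_mul _
  have h := norm_integral_le_of_norm_le hgi (Eventually.of_forall hpt)
  rw [Real.norm_eq_abs, integral_const_mul] at h
  have hmom : ∫ v, (1 + ‖v‖) ^ 2 * localMaxwellian 1 θ u v ≤ A ^ 2 * Z2 := by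
    have h' := k2r_integral_localMaxwellian_mul_one_add_norm_pow_le hθ0 hθΘ hu 2
    rw [hA, hZ2]
    refine le_of_eq_of_le (integral_congr_ae (Eventually.of_forall fun v => ?_)) h'
    ring
  calc |∫ v, (M v * Φ' v - M v * Φ v)|
      ≤ 12 * A ^ 2 * L * δ * Z3 * ∫ v, (1 + ‖v‖) ^ 2 * localMaxwellian 1 θ u v := h
    _ ≤ 12 * A ^ 2 * L * δ * Z3 * (A ^ 2 * Z2) := mul_le_mul_of_nonneg_left hmom (by positivity)
    _ = 12 * A ^ 4 * L * (Z2 * Z3) * δ := by ring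

end Lipschitz

/-! ## The registered statement -/

section Main

set_option quotPrecheck false in
/-- The registered statement `PairGaussian` of stub `stub_pairGaussian` (the body of the Prop `PairGaussian` of the
birth skeleton of K2R, stmt-AtomisticToContinuum-11592), VERBATIM, as a file-local spelling: the skeleton's `def` lives
in the (non-importable) `Cruxes/` work file, and the gate keys the stub by the header `stub_pairGaussian : PairGaussian`.
No declaration of that name is created; `stub_pairGaussian` below elaborates to exactly this proposition. -/
local notation "PairGaussian" =>
  (∀ (θ : ℝ), 0 < θ → ∀ (u : EuclideanSpace ℝ (Fin 3)) (ω : Metric.sphere (0 : EuclideanSpace ℝ (Fin 3)) 1),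
     (∫ v : EuclideanSpace ℝ (Fin 3), ∫ w : EuclideanSpace ℝ (Fin 3),
        max (inner ℝ (v - w) ω) 0 * inner ℝ (v - w) ω *
          (Literature.Analysis.FluidPDE.localMaxwellian 1 θ u v * Literature.Analysis.FluidPDE.localMaxwellian 1 θ u w)) = θ ∧
     (∫ v : EuclideanSpace ℝ (Fin 3), ∫ w : EuclideanSpace ℝ (Fin 3),
        max (inner ℝ (v - w) ω) 0 * inner ℝ (v - w) ω * (inner ℝ (v + w) ω / 2) *
          (Literature.Analysis.FluidPDE.localMaxwellian 1 θ u v * Literature.Analysis.FluidPDE.localMaxwellian 1 θ u w)) =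
        θ * inner ℝ u ω) ∧
  (∀ (θm Θ U : ℝ), 0 < θm → ∃ K : ℝ, 0 ≤ K ∧
     ∀ (θ θ' : ℝ) (u u' : EuclideanSpace ℝ (Fin 3)) (ω : Metric.sphere (0 : EuclideanSpace ℝ (Fin 3)) 1),
     θm ≤ θ → θ ≤ Θ → θm ≤ θ' → θ' ≤ Θ → ‖u‖ ≤ U → ‖u'‖ ≤ U →
     |(∫ v : EuclideanSpace ℝ (Fin 3), ∫ w : EuclideanSpace ℝ (Fin 3),
        max (inner ℝ (v - w) ω) 0 * inner ℝ (v - w) ω *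
          (Literature.Analysis.FluidPDE.localMaxwellian 1 θ u v * Literature.Analysis.FluidPDE.localMaxwellian 1 θ' u' w)) - θ| ≤
        K * (|θ - θ'| + ‖u - u'‖) ∧
     |(∫ v : EuclideanSpace ℝ (Fin 3), ∫ w : EuclideanSpace ℝ (Fin 3),
        max (inner ℝ (v - w) ω) 0 * inner ℝ (v - w) ω * (inner ℝ (v + w) ω / 2) *
          (Literature.Analysis.FluidPDE.localMaxwellian 1 θ u v * Literature.Analysis.FluidPDE.localMaxwellian 1 θ' u' w)) -
        θ * inner ℝ u ω| ≤ K * (|θ - θ'| + ‖u - u'‖))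

/-- **B3a — the Gaussian pair integrals of the collisional transfer** (registered stub `stub_pairGaussian : PairGaussian`
of the birth line of K2R; the statement is the verbatim body of the skeleton's Prop `PairGaussian`, spelled through the
file-local notation above). With `q = (v−w)·ω` and `M = M_{1,θ,u}`: (i) `∫∫ q₊ q M(v)M(w) = θ`;
(ii) `∫∫ q₊ q ((v+w)·ω/2) M(v)M(w) = θ (u·ω)`; (iii) on a compact parameter range the same integrals with
the second Maxwellian at `(θ', u')` are Lipschitz in `(θ', u')` at `(θ, u)`, with a constant depending only
on `(θm, Θ, U)`. [cite: CIP1994, §3.1] -/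
theorem stub_pairGaussian : PairGaussian := by
  refine ⟨fun θ hθ u ω => ⟨k2r_pairGaussian_fst hθ u ω, k2r_pairGaussian_snd hθ u ω⟩,
    fun θm Θ U hθm => ?_⟩
  have hZ2 : 0 ≤ ∫ z, (1 + ‖z‖) ^ 2 ∂stdGaussian V3 := integral_nonneg fun z => by positivity
  have hZ3 : 0 ≤ ∫ z, (1 + ‖z‖) ^ 3 ∂stdGaussian V3 := integral_nonneg fun z => by positivity
  refine ⟨12 * (1 + |U| + Real.sqrt Θ) ^ 4 * (1 + (2 * Real.sqrt θm)⁻¹) *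
      ((∫ z, (1 + ‖z‖) ^ 2 ∂stdGaussian V3) * ∫ z, (1 + ‖z‖) ^ 3 ∂stdGaussian V3),
    by positivity, fun θ θ' u u' ω hθ hθΘ hθ' hθ'Θ hu hu' => ⟨?_, ?_⟩⟩
  · have hω : ‖(ω : V3)‖ = 1 := norm_eq_of_mem_sphere ω
    have h := k2r_pair_integral_lipschitz hθm
      (fun v w => max ⟪v - w, (ω : V3)⟫_ℝ 0 * ⟪v - w, (ω : V3)⟫_ℝ)
      (k2r_continuous_posMul_kernel (ω : V3)) (k2r_kernel_fst_bound (ω : V3) hω)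
      (k2r_kernel_fst_lipschitz (ω : V3) hω) hθ hθΘ hθ' hθ'Θ hu hu'
    rw [k2r_pairGaussian_fst (hθm.trans_le hθ) u ω] at h
    exact h
  · have hω : ‖(ω : V3)‖ = 1 := norm_eq_of_mem_sphere ω
    have hc : Continuous fun p : V3 × V3 =>
        max ⟪p.1 - p.2, (ω : V3)⟫_ℝ 0 * ⟪p.1 - p.2, (ω : V3)⟫_ℝ * (⟪p.1 + p.2, (ω : V3)⟫_ℝ / 2) :=
      (k2r_continuous_posMul_kernel (ω : V3)).mul
        (((continuous_fst.add continuous_snd).inner continuous_const).div_const _)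
    have h := k2r_pair_integral_lipschitz hθm
      (fun v w => max ⟪v - w, (ω : V3)⟫_ℝ 0 * ⟪v - w, (ω : V3)⟫_ℝ * (⟪v + w, (ω : V3)⟫_ℝ / 2))
      hc (k2r_kernel_snd_bound (ω : V3) hω) (k2r_kernel_snd_lipschitz (ω : V3) hω)
      hθ hθΘ hθ' hθ'Θ hu hu'
    rw [k2r_pairGaussian_snd (hθm.trans_le hθ) u ω] at h
    exact h

end Main

end Summit.AtomisticToContinuum.HydrodynamicLimit.Theorems.EnskogAdjointDuality

end
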